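import Summits.FinalStateConjecture.FinalStateConjecture.Theses.SuperenergyCensus
import Literature.Geometry.Lorentzian.TameGenericityDiagonal

/-!
# Crux `GenericCountableKerrSettling` — line `birth`: BIRTH SKELETON (BC3; skeleton registrar, 2026-08-17)

Crux item `stmt-FinalStateConjecture-17465`, decl (FIXED, concluded BY NAME in
`GenericCountableKerrSettling_of` / `GenericCountableKerrSettling_proof`):
`Summit.FinalStateConjecture.FinalStateConjecture.Theses.SuperenergyCensus.GenericCountableKerrSettling`
(route `route-FinalStateConjecture-SuperenergyCensus`, crux rank 2) — the GENERIC crux `G` of the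
superenergy-census route: for every data manifold `X`, tame-Christodoulou-generically in the
admissible class, an MGHD exists and every MGHD `𝒟` has complete `𝓘⁺` and settles in `C²` to a
family of sub-extremal boosted Kerr near zones indexed by an ARBITRARY type `ι` plus a flat
radiation zone (the summit's near/far/`O = exteriorOf`/rays/honest-radii exhaustion/orientation
clauses verbatim with `Fin N ↦ ι`), together with a DR end `(e, M)` of the datum, the REMNANT MASS
BOUND `Mᵢ ≤ M` and the LATE COLLAR-SUPERENERGY BUDGET `∃ C < ∞, ∀ finite s ⊆ ι, ∃ᶠ τ, Σ_{i∈s} 𝓔ᵢ(τ) ≤ C`.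

## The cut — "one generic picture, two deterministic ledgers", typed over existing declarations

Tame Christodoulou genericity is NOT closed under `∧` but IS monotone in the property
(`InitialDataSet.IsTameChristodoulouGeneric.mono`, `TameGenericityDiagonal.lean`, landed). So
exactly ONE stub is generic — the qualitative final-state picture WITHOUT finiteness and without
any quantitative clause — and the two quantitative clauses of `G`, which are statements about ANY
honestly settled `ι`-family in ANY MGHD of an admissible datum, are deterministic stubs supplied
pointwise under `mono`; MGHD existence (known in print) is the fourth:

* `stub_mghdExists` — MGHD EXISTENCE for admissible data (Choquet-Bruhat–Geroch 1969, Thm. 3;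
  Sbierski 2016, Thm. 2.8). KNOWN in print; byte-identical to the registered stub `stub_mghdExists`
  of `Cruxes/GenericCensoredHolesSettle/Lines/birth.lean` and to the shared item
  `AdmissibleMGHDExists` (stmt-FinalStateConjecture-9937); in the tree it follows from the named
  fact `choquetBruhat_geroch_exists_mghd_cauchy`. [known; XL as a formalisation]
* `stub_countableSettling` — TAME-GENERIC COUNTABLE KERR SETTLING: tame-generically in the
  admissible class, every MGHD has complete `𝓘⁺` (weak cosmic censorship sits here, as in the
  summit) and admits an `ι`-indexed honest settled family — `G` with the DR end, the mass bound and
  the superenergy budget DROPPED, i.e. the summit's conclusion with `Fin N` replaced by an arbitrary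
  index type and nothing else. A genuine WEAKENING of the crux (`countableSettling_of_crux`, §4,
  sorry-free). [open-problem; XL]
* `stub_remnantMassBound` — REMNANT MASSES ARE BOUNDED BY THE ADM MASS (deterministic): for every
  admissible datum with sole DR end `(e, M)`, every MGHD with complete `𝓘⁺` and every honestly
  settled `ι`-family in it, `Mᵢ ≤ M` for all `i`. Bondi bookkeeping: `M_ADM ≥ M_Bondi(u) ≥ 0`
  (Bondi–van der Burg–Metzner 1962 mass loss; positivity of the Bondi mass, Schoen–Yau 1982 /
  Ludvigsen–Vickers 1982) and the final Bondi mass dominates the boosted energy `γᵢ Mᵢ ≥ Mᵢ` of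
  each remnant. [believed; L–XL: no Bondi mass in the prelude yet]
* `stub_collarBudget` — LATE COLLAR-SUPERENERGY BUDGET (deterministic; the route's L²
  NON-CONCENTRATION bet isolated as one named target): for every admissible datum, every MGHD with
  complete `𝓘⁺` and every honestly settled `ι`-family, the coordinate Bel–Robinson superenergies
  `𝓔ᵢ(τ) = (1/8)∫_{t*ᵢ=τ, r₊<rᵢ≤4Mᵢ} |Rm_{Ψᵢ*g}|²_ĝ` of the certified Kerr–Schild collars, summed
  over any finite set of holes, are frequently-in-`τ` bounded by one `C < ∞`. For FINITE `ι` this is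
  the convergence `𝓔ᵢ(τ) → J(Λᵢ)·𝓔_Kerr(Mᵢ, aᵢ)` of coordinate-curvature integrals under `C²`
  convergence on the collars (M-sized); for infinite `ι` it is exactly the analytic content the
  census `InvertedQuantumCensus` converts into finiteness. [open; L]

Typed form of the family (Stubs 1–3): verbatim the clause groups of the crux (near · far · `O = exteriorOf` ·
rays · orientation, and the collar-superenergy term), under `open Literature.Geometry.Lorentzian`, with
the crux's three `let`-abbreviations `B` (boosted Kerr backgrounds), `M₀` (Minkowski background on
`U₀`) and `G` (components of `Ψᵢ*g`) bound instead as VARIABLES WITH DEFINING EQUATIONS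
(`∀ B, B = (fun i ↦ boostedKerrBackground …) → …`, resp. `∃ B, B = … ∧ …`; charts typed over
`(B i).domain` / `M₀.domain`, definitionally the crux's `boostedKerrExterior …` / `U₀`): logically
the same statements, and no `:=` occurs inside a registered signature (the registrar records a
stub's signature up to its first `:=`). The composition `subst`s the equations.

Composition `GenericCountableKerrSettling_of` (kernel-checked, no `sorry` of its own): `mono` with
the pointwise upgrade — MGHD existence from Stub 0, the DR end `(e, M)` from admissibility
(`exists_isSoleEnd_of_mem_admissibleVacuumData`), the family and its five clause groups from
Stub 1, the mass bound from Stub 2, the budget from Stub 3.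

Disproof used: none on file (`ledger crux ls stmt-FinalStateConjecture-17465`: no `Disproof.lean`,
no `Negative/` lemma for this crux, negatives index empty for the summit at registration).
Logical position: crux ⇒ Stub 1 (§4); Stubs 2–3 are deterministic strengthenings of the
corresponding clauses of the crux (they quantify over ALL admissible data, not generic ones) — the
line's bet, recorded as such in `Lines/birth.md`.
-/

set_option linter.dupNamespace false

namespace Summit.FinalStateConjecture.FinalStateConjecture.Cruxes.GenericCountableKerrSettling.Birth

open scoped BigOperators Topology Manifold Classical MeasureTheory Matrix InnerProductSpace ContDiff
open Filter Set Function TopologicalSpace MeasureTheory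
open Literature.Geometry.Lorentzian
open Summit.FinalStateConjecture.FinalStateConjecture.Theses.SuperenergyCensus

/-! ## §1 The four statements of the line (named; nothing here is a route item) -/

/-- **MGHD EXISTENCE for admissible data** (`stub_mghdExists`): every datum of Christodoulou's
admissible class on every connected Hausdorff second-countable `3`-manifold has a maximal vacuum
Cauchy development (`VacuumCauchyDevelopment`, `IsMaximal`). Choquet-Bruhat–Geroch, CMP 14 (1969),
Thm. 3; Sbierski, AHP 17 (2016) = arXiv:1309.7591, Thm. 2.8. Known in print; in the tree the
unproved named fact `choquetBruhat_geroch_exists_mghd_cauchy`. Why it might fail (as a tree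
statement): `IsMaximal` asks every typed vacuum Cauchy development of `D` to embed into one `𝒟`; a
typing defect of the prelude, not the mathematics, is the risk.
[cite: ChoquetBruhatGeroch1969CMP, Thm. 3 (p. 332)] -/
def AdmissibleMGHDExistence : Prop :=
  ∀ (X : Type) [TopologicalSpace X] [ChartedSpace Literature.Geometry.Lorentzian.E3 X] [IsManifold (𝓡 3) ((⊤ : ℕ∞) : WithTop ℕ∞) X] [T2Space X] [SecondCountableTopology X] [ConnectedSpace X], ∀ D ∈ Literature.Geometry.Lorentzian.admissibleVacuumData X, ∃ 𝒟 : Literature.Geometry.Lorentzian.VacuumCauchyDevelopment D, 𝒟.IsMaximal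

/-- **TAME-GENERIC COUNTABLE KERR SETTLING** (`stub_countableSettling`): for every connected
Hausdorff second-countable `3`-manifold `X`, tame-Christodoulou-generically in the admissible class
(codimension `1`, witness curves on ONE fixed end, `wDist`-continuous, immersed at `0`), every MGHD
`𝒟` has complete future null infinity and there are a region `O`, an index type `ι`, sub-extremal
parameters `(Mᵢ, aᵢ)`, Poincaré motions, a late time `τ₀`, hole charts `Ψᵢ` and a flat chart `Ψ₀`
with: the near-zone clauses (late charts into `O`, `C²` deviation from boosted Kerr `→ 0` on every
truncated slab), the far-zone clauses (eventual pairwise disjointness, sublinear excision, flat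
domain, flat late chart, `C²` deviation from `η → 0`, covering, honest-radii exhaustion),
`O = exteriorOf 𝒟 (charted)`, `RaysStayInClosure 𝒟 O`, and future orientation — verbatim the
clauses of the crux, with its DR end, mass bound and superenergy budget dropped. The summit's
conclusion with `Fin N ↦ ι`: weak cosmic censorship + large-data asymptotic Kerr settling WITHOUT
"finitely many". Why it might fail: contains weak cosmic censorship (Christodoulou 1999) and
large-data multi-Kerr asymptotic stability (known only near slowly rotating Kerr,
Klainerman–Szeftel); generic extremal remnants (Kehle–Unger) or a generic non-Kerr censored end
state refute it exactly as they would refute the summit. [cite: DafermosLuk2017, Conjecture 1]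
[cite: Christodoulou1999, p. A24] [cite: KlainermanSzeftel2023] -/
def CountableSettling : Prop :=
  ∀ (X : Type) [TopologicalSpace X] [ChartedSpace E3 X] [IsManifold (𝓡 3) (⊤ : ℕ∞) X] [T2Space X] [SecondCountableTopology X] [ConnectedSpace X], InitialDataSet.IsTameChristodoulouGeneric (admissibleVacuumData X) (fun D ↦ ∀ 𝒟 : VacuumCauchyDevelopment D, 𝒟.IsMaximal → Summit.FinalStateConjecture.HasCompleteNullInfinity 𝒟.toCauchyDevelopment ∧ ∃ (O : Set 𝒟.carrier) (ι : Type) (mass spin : ι → ℝ) (motion : ι → lorentzGroup × E4) (τ₀ : ℝ) (B : ι → ModelBackground), B = (fun i ↦ boostedKerrBackground (motion i).1 (motion i).2 (mass i) (spin i)) ∧ ∃ (Ψ : ∀ i, (B i).domain → 𝒟.carrier) (ρ : ι → ℝ → ℝ) (U₀ : TopologicalSpace.Opens E4) (M₀ : ModelBackground), M₀ = Minkowski.backgroundOn U₀ ∧ ∃ (Ψ₀ : M₀.domain → 𝒟.carrier), ((∀ i, Kerr.IsSubextremal (mass i) (spin i)) ∧ (∀ i, 𝒟.IsLateChart (B i)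 O τ₀ (Ψ i)) ∧ (∀ i R, Tendsto (fun τ ↦ 𝒟.truncDeviationCk (B i) (Ψ i) 2 R τ) atTop (nhds 0))) ∧ ((∀ R, ∃ τ₁, Pairwise (Function.onFun Disjoint fun i ↦ Ψ i '' (B i).truncLateRegion τ₁ R)) ∧ (∀ i, Tendsto (fun t ↦ ρ i t / t) atTop (nhds 0)) ∧ ({x : E4 | τ₀ < x 0 ∧ ∀ i, ρ i (x 0) < Kerr.radius (spin i) (poincareInv (motion i).1 (motion i).2 x)} ⊆ (U₀ : Set E4)) ∧ 𝒟.IsLateChart M₀ O τ₀ Ψ₀ ∧ Tendsto (fun τ ↦ 𝒟.deviationCk M₀ Ψ₀ 2 τ) atTop (nhds 0) ∧ (O \ ((⋃ i, Ψ i '' (B i).lateRegion τ₀) ∪ Ψ₀ '' M₀.lateRegion τ₀) ⊆ 𝒟.metric.causalPast 𝒟.timeOrientation ((⋃ i, Ψ i '' (B i).timeSlab τ₀) ∪ Ψ₀ '' M₀.timeSlab τ₀)) ∧ (∃ R : ι → ℝ → ℝ, (∀ i, Tendsto (R i) atTop atTop ∧ ∀ τ, max (Kerr.rPlus (mass i)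 (spin i)) 0 + 1 ≤ R i τ) ∧ (∀ i, Tendsto (fun τ ↦ 𝒟.truncDeviationCk (B i) (Ψ i) 2 (R i τ) τ) atTop (nhds 0)) ∧ ∀ τ₁, τ₀ < τ₁ → O \ (Ψ₀ '' M₀.lateRegion τ₁ ∪ ⋃ i, Ψ i '' {x | τ₁ < (B i).time x.1 ∧ (B i).radius x.1 ≤ R i ((B i).time x.1)}) ⊆ 𝒟.metric.causalPast 𝒟.timeOrientation (Ψ₀ '' M₀.timeSlab τ₁ ∪ ⋃ i, Ψ i '' (B i).truncTimeSlab (R i τ₁) τ₁))) ∧ O = Summit.FinalStateConjecture.exteriorOf 𝒟.toCauchyDevelopment (Ψ₀ '' M₀.lateRegion τ₀ ∪ ⋃ i, Ψ i '' (B i).lateRegion τ₀) ∧ Summit.FinalStateConjecture.RaysStayInClosure 𝒟.toCauchyDevelopment O ∧ ((∀ i, Summit.FinalStateConjecture.IsOrthochronous (motion i).1) ∧ (∀ i r, ∀ᶠ τ in atTop, ∀ x ∈ (B i).truncTimeSlab r τ, 𝒟.timeOrientation.IsFutureDirected (mfderiv 𝓘(ℝ, E4) (𝓡 4) (Ψ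 i) x (((motion i).1 : E4 ≃L[ℝ] E4) (Kerr.timeVector (mass i) (spin i) (poincareInv (motion i).1 (motion i).2 x.1))))) ∧ ∀ᶠ τ in atTop, ∀ x ∈ M₀.timeSlab τ, 𝒟.timeOrientation.IsFutureDirected (mfderiv 𝓘(ℝ, E4) (𝓡 4) Ψ₀ x (E4.basisVector 0)))) 1

/-- **REMNANT MASSES ARE BOUNDED BY THE ADM MASS** (`stub_remnantMassBound`, deterministic): for
every admissible datum `D` with a sole, Dafermos–Rodnianski strongly asymptotically flat end `e` of
mass parameter `M`, every MGHD `𝒟` of `D` with complete `𝓘⁺`, and every honestly settled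
`ι`-family in `𝒟` (all clauses of `CountableSettling`), each hole's Kerr mass satisfies `Mᵢ ≤ M`.
Mechanism: `M = M_ADM ≥ lim_u M_Bondi(u) ≥ Σ γᵢ Mᵢ ≥ Mᵢ` — Bondi–van der Burg–Metzner mass loss,
positivity of the Bondi mass (Schoen–Yau 1982; Ludvigsen–Vickers 1982), and convergence of the
Bondi data to the superposed boosted Kerr far fields. Why it might fail: the prelude has no `𝓘⁺`
as a boundary and no Bondi mass, so the proof is far off; as a STATEMENT it fails only if an
honestly settled hole chart (late chart into `O = J⁺(ιX) ∩ I⁻(charted)`, rays stay in `closure O`,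
exhaustive charts) can carry a Kerr mass parameter exceeding the ADM mass — excluded by the
positive-mass/Bondi-loss heuristics but unproved at this generality. [cite: BondiVanderburgMetzner1962]
[cite: DafermosLuk2017, Conjecture 1] -/
def RemnantMassBound : Prop :=
  ∀ (X : Type) [TopologicalSpace X] [ChartedSpace E3 X] [IsManifold (𝓡 3) (⊤ : ℕ∞) X] [T2Space X] [SecondCountableTopology X] [ConnectedSpace X], ∀ D ∈ admissibleVacuumData X, ∀ (e : AFEnd X) (M : ℝ), e.IsSoleEnd → e.IsStronglyAsymptoticallyFlatDR D M → ∀ 𝒟 : VacuumCauchyDevelopment D, 𝒟.IsMaximal → Summit.FinalStateConjecture.HasCompleteNullInfinity 𝒟.toCauchyDevelopment → ∀ (O : Set 𝒟.carrier) (ι : Type) (mass spin : ι → ℝ) (motion : ι → lorentzGroup × E4) (τ₀ : ℝ) (B : ι → ModelBackground), B = (fun i ↦ boostedKerrBackground (motion i).1 (motion i).2 (mass i) (spin i)) → ∀ (Ψ : ∀ i, (B i).domain → 𝒟.carrier) (ρ : ι → ℝ → ℝ) (U₀ : TopologicalSpace.Opens E4) (M₀ : ModelBackground), M₀ = Minkowski.backgroundOn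 U₀ → ∀ (Ψ₀ : M₀.domain → 𝒟.carrier), (((∀ i, Kerr.IsSubextremal (mass i) (spin i)) ∧ (∀ i, 𝒟.IsLateChart (B i) O τ₀ (Ψ i)) ∧ (∀ i R, Tendsto (fun τ ↦ 𝒟.truncDeviationCk (B i) (Ψ i) 2 R τ) atTop (nhds 0))) ∧ ((∀ R, ∃ τ₁, Pairwise (Function.onFun Disjoint fun i ↦ Ψ i '' (B i).truncLateRegion τ₁ R)) ∧ (∀ i, Tendsto (fun t ↦ ρ i t / t) atTop (nhds 0)) ∧ ({x : E4 | τ₀ < x 0 ∧ ∀ i, ρ i (x 0) < Kerr.radius (spin i) (poincareInv (motion i).1 (motion i).2 x)} ⊆ (U₀ : Set E4)) ∧ 𝒟.IsLateChart M₀ O τ₀ Ψ₀ ∧ Tendsto (fun τ ↦ 𝒟.deviationCk M₀ Ψ₀ 2 τ) atTop (nhds 0) ∧ (O \ ((⋃ i, Ψ i '' (B i).lateRegion τ₀) ∪ Ψ₀ '' M₀.lateRegion τ₀) ⊆ 𝒟.metric.causalPast 𝒟.timeOrientation ((⋃ i, Ψ i '' (B i).timeSlab τ₀) ∪ Ψ₀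 '' M₀.timeSlab τ₀)) ∧ (∃ R : ι → ℝ → ℝ, (∀ i, Tendsto (R i) atTop atTop ∧ ∀ τ, max (Kerr.rPlus (mass i) (spin i)) 0 + 1 ≤ R i τ) ∧ (∀ i, Tendsto (fun τ ↦ 𝒟.truncDeviationCk (B i) (Ψ i) 2 (R i τ) τ) atTop (nhds 0)) ∧ ∀ τ₁, τ₀ < τ₁ → O \ (Ψ₀ '' M₀.lateRegion τ₁ ∪ ⋃ i, Ψ i '' {x | τ₁ < (B i).time x.1 ∧ (B i).radius x.1 ≤ R i ((B i).time x.1)}) ⊆ 𝒟.metric.causalPast 𝒟.timeOrientation (Ψ₀ '' M₀.timeSlab τ₁ ∪ ⋃ i, Ψ i '' (B i).truncTimeSlab (R i τ₁) τ₁))) ∧ O = Summit.FinalStateConjecture.exteriorOf 𝒟.toCauchyDevelopment (Ψ₀ '' M₀.lateRegion τ₀ ∪ ⋃ i, Ψ i '' (B i).lateRegion τ₀) ∧ Summit.FinalStateConjecture.RaysStayInClosure 𝒟.toCauchyDevelopment O ∧ ((∀ i, Summit.FinalStateConjecture.IsOrthochronous (motion i).1) ∧ (∀ i r, ∀ᶠ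 τ in atTop, ∀ x ∈ (B i).truncTimeSlab r τ, 𝒟.timeOrientation.IsFutureDirected (mfderiv 𝓘(ℝ, E4) (𝓡 4) (Ψ i) x (((motion i).1 : E4 ≃L[ℝ] E4) (Kerr.timeVector (mass i) (spin i) (poincareInv (motion i).1 (motion i).2 x.1))))) ∧ ∀ᶠ τ in atTop, ∀ x ∈ M₀.timeSlab τ, 𝒟.timeOrientation.IsFutureDirected (mfderiv 𝓘(ℝ, E4) (𝓡 4) Ψ₀ x (E4.basisVector 0)))) → ∀ i, mass i ≤ M

/-- **LATE COLLAR-SUPERENERGY BUDGET** (`stub_collarBudget`, deterministic; the route's `L²`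
non-concentration clause as one named target): for every admissible datum, every MGHD `𝒟` with
complete `𝓘⁺` and every honestly settled `ι`-family in `𝒟`, there is `C < ∞` such that for every
finite set `s` of holes, frequently as `τ → ∞`, `Σ_{i∈s} 𝓔ᵢ(τ) ≤ C`, where
`𝓔ᵢ(τ) = (1/8) ∫_{y ∈ domᵢ, t*ᵢ(y) = τ, rᵢ(y) ≤ 4Mᵢ} |Rm_G|²_ĝ dμ_{H³}`, `G = Ψᵢ*g` in Kerr–Schild
coordinates (deviation + background), `ĝ = G + 2N² dt*ᵢ ⊗ dt*ᵢ`, `N² = −1/G⁻¹(dt*ᵢ, dt*ᵢ)` — the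
coordinate Bel–Robinson superenergy `Q(n,n,n,n)` of the certified collar, verbatim the last clause
of the crux. For finite `ι`: `C²` convergence on the collars gives `𝓔ᵢ(τ) → J(Λᵢ)·𝓔_Kerr(Mᵢ, aᵢ)`
and the budget holds eventually (M-sized analysis: continuity of `MetricCoord.rm4`/`tnormSq` under
`C²` sup-norm convergence, uniform non-degeneracy of `Ψᵢ*g` down to `r → r₊⁺`). For infinite `ι`
it is the bet of the route: curvature cannot concentrate on infinitely many ever-smaller collars in
an MGHD of finite-mass admissible data. Why it might fail: an admissible (non-generic!) MGHD whose
exterior is honestly exhausted by infinitely many settled holes would have divergent collar sums by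
the Kerr floor `𝓔_Kerr(M, a) ≥ c/M` — the statement is deterministic, so ONE such development
refutes it even if generic data never do this. [cite: Senovilla2000, §§2–4]
[cite: ChristodoulouKlainerman1993, Ch. 7] [cite: KlainermanRodnianskiSzeftel2015, Thm. 2.2] -/
def CollarBudget : Prop :=
  ∀ (X : Type) [TopologicalSpace X] [ChartedSpace E3 X] [IsManifold (𝓡 3) (⊤ : ℕ∞) X] [T2Space X] [SecondCountableTopology X] [ConnectedSpace X], ∀ D ∈ admissibleVacuumData X, ∀ 𝒟 : VacuumCauchyDevelopment D, 𝒟.IsMaximal → Summit.FinalStateConjecture.HasCompleteNullInfinity 𝒟.toCauchyDevelopment → ∀ (O : Set 𝒟.carrier) (ι : Type) (mass spin : ι → ℝ) (motion : ι → lorentzGroup × E4) (τ₀ : ℝ) (B : ι → ModelBackground), B = (fun i ↦ boostedKerrBackground (motion i).1 (motion i).2 (mass i) (spin i)) → ∀ (Ψ : ∀ i, (B i).domain → 𝒟.carrier) (ρ : ι → ℝ → ℝ) (U₀ : TopologicalSpace.Opens E4) (M₀ : ModelBackground), M₀ = Minkowski.backgroundOn U₀ → ∀ (Ψ₀ : M₀.domain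 → 𝒟.carrier), ∀ (G : ι → E4 → (E4 →L[ℝ] E4 →L[ℝ] ℝ)), G = (fun i w ↦ 𝒟.deviationExtend (B i) (Ψ i) w + (B i).bilin w) → (((∀ i, Kerr.IsSubextremal (mass i) (spin i)) ∧ (∀ i, 𝒟.IsLateChart (B i) O τ₀ (Ψ i)) ∧ (∀ i R, Tendsto (fun τ ↦ 𝒟.truncDeviationCk (B i) (Ψ i) 2 R τ) atTop (nhds 0))) ∧ ((∀ R, ∃ τ₁, Pairwise (Function.onFun Disjoint fun i ↦ Ψ i '' (B i).truncLateRegion τ₁ R)) ∧ (∀ i, Tendsto (fun t ↦ ρ i t / t) atTop (nhds 0)) ∧ ({x : E4 | τ₀ < x 0 ∧ ∀ i, ρ i (x 0) < Kerr.radius (spin i) (poincareInv (motion i).1 (motion i).2 x)} ⊆ (U₀ : Set E4)) ∧ 𝒟.IsLateChart M₀ O τ₀ Ψ₀ ∧ Tendsto (fun τ ↦ 𝒟.deviationCk M₀ Ψ₀ 2 τ) atTop (nhds 0) ∧ (O \ ((⋃ i, Ψ i '' (B i).lateRegion τ₀) ∪ Ψ₀ '' M₀.lateRegion τ₀) ⊆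 𝒟.metric.causalPast 𝒟.timeOrientation ((⋃ i, Ψ i '' (B i).timeSlab τ₀) ∪ Ψ₀ '' M₀.timeSlab τ₀)) ∧ (∃ R : ι → ℝ → ℝ, (∀ i, Tendsto (R i) atTop atTop ∧ ∀ τ, max (Kerr.rPlus (mass i) (spin i)) 0 + 1 ≤ R i τ) ∧ (∀ i, Tendsto (fun τ ↦ 𝒟.truncDeviationCk (B i) (Ψ i) 2 (R i τ) τ) atTop (nhds 0)) ∧ ∀ τ₁, τ₀ < τ₁ → O \ (Ψ₀ '' M₀.lateRegion τ₁ ∪ ⋃ i, Ψ i '' {x | τ₁ < (B i).time x.1 ∧ (B i).radius x.1 ≤ R i ((B i).time x.1)}) ⊆ 𝒟.metric.causalPast 𝒟.timeOrientation (Ψ₀ '' M₀.timeSlab τ₁ ∪ ⋃ i, Ψ i '' (B i).truncTimeSlab (R i τ₁) τ₁))) ∧ O = Summit.FinalStateConjecture.exteriorOf 𝒟.toCauchyDevelopment (Ψ₀ '' M₀.lateRegion τ₀ ∪ ⋃ i, Ψ i '' (B i).lateRegion τ₀) ∧ Summit.FinalStateConjecture.RaysStayInClosure 𝒟.toCauchyDevelopment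 O ∧ ((∀ i, Summit.FinalStateConjecture.IsOrthochronous (motion i).1) ∧ (∀ i r, ∀ᶠ τ in atTop, ∀ x ∈ (B i).truncTimeSlab r τ, 𝒟.timeOrientation.IsFutureDirected (mfderiv 𝓘(ℝ, E4) (𝓡 4) (Ψ i) x (((motion i).1 : E4 ≃L[ℝ] E4) (Kerr.timeVector (mass i) (spin i) (poincareInv (motion i).1 (motion i).2 x.1))))) ∧ ∀ᶠ τ in atTop, ∀ x ∈ M₀.timeSlab τ, 𝒟.timeOrientation.IsFutureDirected (mfderiv 𝓘(ℝ, E4) (𝓡 4) Ψ₀ x (E4.basisVector 0)))) → ∃ C < (⊤ : ENNReal), ∀ s : Finset ι, ∃ᶠ τ in atTop, (∑ i ∈ s, ∫⁻ y in {y | y ∈ (B i).domain ∧ (B i).time y = τ ∧ (B i).radius y ≤ 4 * mass i}, ENNReal.ofReal ((1 / 8 : ℝ) * MetricCoord.tnormSq (fun z ↦ G i z + (2 * (-((fderiv ℝ (B i).time z) (MetricCoord.sharpAt (G i) z (fderiv ℝ (B i).time z))))⁻¹) • E4.tmul (fderiv ℝ (B i).time z) (fderiv ℝ (B i).time z)) (EuclideanSpace.basisFun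 (Fin 4) ℝ).toBasis (MetricCoord.rm4 (G i) (EuclideanSpace.basisFun (Fin 4) ℝ).toBasis) y) ∂μH[3]) ≤ C

/-! ### Statements of the registered stubs, under the stub names
The skeleton audit reads the hypotheses of `GenericCountableKerrSettling_of` BY NAME: each head is
a declared stub. -/
namespace Goal

/-- Statement of `stub_mghdExists`. -/
abbrev stub_mghdExists : Prop := AdmissibleMGHDExistence
/-- Statement of `stub_countableSettling`. -/
abbrev stub_countableSettling : Prop := CountableSettling
/-- Statement of `stub_remnantMassBound`. -/
abbrev stub_remnantMassBound : Prop := RemnantMassBound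
/-- Statement of `stub_collarBudget`. -/
abbrev stub_collarBudget : Prop := CollarBudget

end Goal

/-! ## §2 Registered stubs (the four `sorry`s of the file), stated EXPANDED over existing
declarations (Statement + Literature prelude; no vocabulary of this file occurs in a stub signature).
Stub 0 is fully qualified (byte-identical to its registrations elsewhere); Stubs 1–3 use the short
prelude names: a Theorems file proving one elaborates the registered signature verbatim after
`open Literature.Geometry.Lorentzian`, `open Filter Set MeasureTheory` and
`open scoped Manifold MeasureTheory BigOperators Topology` (as in this file). -/

/-- **Stub 0** (known in print, XL as a formalisation): MGHD existence for admissible data — see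
`AdmissibleMGHDExistence`. [cite: ChoquetBruhatGeroch1969CMP, Thm. 3 (p. 332)] -/
theorem stub_mghdExists :
    ∀ (X : Type) [TopologicalSpace X] [ChartedSpace Literature.Geometry.Lorentzian.E3 X] [IsManifold (𝓡 3) ((⊤ : ℕ∞) : WithTop ℕ∞) X] [T2Space X] [SecondCountableTopology X] [ConnectedSpace X], ∀ D ∈ Literature.Geometry.Lorentzian.admissibleVacuumData X, ∃ 𝒟 : Literature.Geometry.Lorentzian.VacuumCauchyDevelopment D, 𝒟.IsMaximal := by
  sorry

/-- **Stub 1** (XL, open-problem): tame-generic countable Kerr settling — see `CountableSettling`.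
[cite: DafermosLuk2017, Conjecture 1] [cite: Christodoulou1999, p. A24] -/
theorem stub_countableSettling :
    ∀ (X : Type) [TopologicalSpace X] [ChartedSpace E3 X] [IsManifold (𝓡 3) (⊤ : ℕ∞) X] [T2Space X] [SecondCountableTopology X] [ConnectedSpace X], InitialDataSet.IsTameChristodoulouGeneric (admissibleVacuumData X) (fun D ↦ ∀ 𝒟 : VacuumCauchyDevelopment D, 𝒟.IsMaximal → Summit.FinalStateConjecture.HasCompleteNullInfinity 𝒟.toCauchyDevelopment ∧ ∃ (O : Set 𝒟.carrier) (ι : Type) (mass spin : ι → ℝ) (motion : ι → lorentzGroup × E4) (τ₀ : ℝ) (B : ι → ModelBackground), B = (fun i ↦ boostedKerrBackground (motion i).1 (motion i).2 (mass i) (spin i)) ∧ ∃ (Ψ : ∀ i, (B i).domain → 𝒟.carrier) (ρ : ι → ℝ → ℝ) (U₀ : TopologicalSpace.Opens E4) (M₀ : ModelBackground), M₀ = Minkowski.backgroundOn U₀ ∧ ∃ (Ψ₀ : M₀.domain → 𝒟.carrier), ((∀ i, Kerr.IsSubextremal (mass i) (spin i)) ∧ (∀ i, 𝒟.IsLateChart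 (B i) O τ₀ (Ψ i)) ∧ (∀ i R, Tendsto (fun τ ↦ 𝒟.truncDeviationCk (B i) (Ψ i) 2 R τ) atTop (nhds 0))) ∧ ((∀ R, ∃ τ₁, Pairwise (Function.onFun Disjoint fun i ↦ Ψ i '' (B i).truncLateRegion τ₁ R)) ∧ (∀ i, Tendsto (fun t ↦ ρ i t / t) atTop (nhds 0)) ∧ ({x : E4 | τ₀ < x 0 ∧ ∀ i, ρ i (x 0) < Kerr.radius (spin i) (poincareInv (motion i).1 (motion i).2 x)} ⊆ (U₀ : Set E4)) ∧ 𝒟.IsLateChart M₀ O τ₀ Ψ₀ ∧ Tendsto (fun τ ↦ 𝒟.deviationCk M₀ Ψ₀ 2 τ) atTop (nhds 0) ∧ (O \ ((⋃ i, Ψ i '' (B i).lateRegion τ₀) ∪ Ψ₀ '' M₀.lateRegion τ₀) ⊆ 𝒟.metric.causalPast 𝒟.timeOrientation ((⋃ i, Ψ i '' (B i).timeSlab τ₀) ∪ Ψ₀ '' M₀.timeSlab τ₀)) ∧ (∃ R : ι → ℝ → ℝ, (∀ i, Tendsto (R i) atTop atTop ∧ ∀ τ, max (Kerr.rPlus (mass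 i) (spin i)) 0 + 1 ≤ R i τ) ∧ (∀ i, Tendsto (fun τ ↦ 𝒟.truncDeviationCk (B i) (Ψ i) 2 (R i τ) τ) atTop (nhds 0)) ∧ ∀ τ₁, τ₀ < τ₁ → O \ (Ψ₀ '' M₀.lateRegion τ₁ ∪ ⋃ i, Ψ i '' {x | τ₁ < (B i).time x.1 ∧ (B i).radius x.1 ≤ R i ((B i).time x.1)}) ⊆ 𝒟.metric.causalPast 𝒟.timeOrientation (Ψ₀ '' M₀.timeSlab τ₁ ∪ ⋃ i, Ψ i '' (B i).truncTimeSlab (R i τ₁) τ₁))) ∧ O = Summit.FinalStateConjecture.exteriorOf 𝒟.toCauchyDevelopment (Ψ₀ '' M₀.lateRegion τ₀ ∪ ⋃ i, Ψ i '' (B i).lateRegion τ₀) ∧ Summit.FinalStateConjecture.RaysStayInClosure 𝒟.toCauchyDevelopment O ∧ ((∀ i, Summit.FinalStateConjecture.IsOrthochronous (motion i).1) ∧ (∀ i r, ∀ᶠ τ in atTop, ∀ x ∈ (B i).truncTimeSlab r τ, 𝒟.timeOrientation.IsFutureDirected (mfderiv 𝓘(ℝ, E4) (𝓡 4) (Ψ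 i) x (((motion i).1 : E4 ≃L[ℝ] E4) (Kerr.timeVector (mass i) (spin i) (poincareInv (motion i).1 (motion i).2 x.1))))) ∧ ∀ᶠ τ in atTop, ∀ x ∈ M₀.timeSlab τ, 𝒟.timeOrientation.IsFutureDirected (mfderiv 𝓘(ℝ, E4) (𝓡 4) Ψ₀ x (E4.basisVector 0)))) 1 := by
  sorry

/-- **Stub 2** (L–XL, believed): remnant masses are bounded by the ADM mass — see
`RemnantMassBound`. [cite: BondiVanderburgMetzner1962] -/
theorem stub_remnantMassBound :
    ∀ (X : Type) [TopologicalSpace X] [ChartedSpace E3 X] [IsManifold (𝓡 3) (⊤ : ℕ∞) X] [T2Space X] [SecondCountableTopology X] [ConnectedSpace X], ∀ D ∈ admissibleVacuumData X, ∀ (e : AFEnd X) (M : ℝ), e.IsSoleEnd → e.IsStronglyAsymptoticallyFlatDR D M → ∀ 𝒟 : VacuumCauchyDevelopment D, 𝒟.IsMaximal → Summit.FinalStateConjecture.HasCompleteNullInfinity 𝒟.toCauchyDevelopment → ∀ (O : Set 𝒟.carrier) (ι : Type) (mass spin : ι → ℝ) (motion : ι → lorentzGroup × E4) (τ₀ :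 ℝ) (B : ι → ModelBackground), B = (fun i ↦ boostedKerrBackground (motion i).1 (motion i).2 (mass i) (spin i)) → ∀ (Ψ : ∀ i, (B i).domain → 𝒟.carrier) (ρ : ι → ℝ → ℝ) (U₀ : TopologicalSpace.Opens E4) (M₀ : ModelBackground), M₀ = Minkowski.backgroundOn U₀ → ∀ (Ψ₀ : M₀.domain → 𝒟.carrier), (((∀ i, Kerr.IsSubextremal (mass i) (spin i)) ∧ (∀ i, 𝒟.IsLateChart (B i) O τ₀ (Ψ i)) ∧ (∀ i R, Tendsto (fun τ ↦ 𝒟.truncDeviationCk (B i) (Ψ i) 2 R τ) atTop (nhds 0))) ∧ ((∀ R, ∃ τ₁, Pairwise (Function.onFun Disjoint fun i ↦ Ψ i '' (B i).truncLateRegion τ₁ R)) ∧ (∀ i, Tendsto (fun t ↦ ρ i t / t) atTop (nhds 0)) ∧ ({x : E4 | τ₀ < x 0 ∧ ∀ i, ρ i (x 0) < Kerr.radius (spin i) (poincareInv (motion i).1 (motion i).2 x)} ⊆ (U₀ : Set E4)) ∧ 𝒟.IsLateChart M₀ O τ₀ Ψ₀ ∧ Tendsto (fun τ ↦ 𝒟.deviationCk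 M₀ Ψ₀ 2 τ) atTop (nhds 0) ∧ (O \ ((⋃ i, Ψ i '' (B i).lateRegion τ₀) ∪ Ψ₀ '' M₀.lateRegion τ₀) ⊆ 𝒟.metric.causalPast 𝒟.timeOrientation ((⋃ i, Ψ i '' (B i).timeSlab τ₀) ∪ Ψ₀ '' M₀.timeSlab τ₀)) ∧ (∃ R : ι → ℝ → ℝ, (∀ i, Tendsto (R i) atTop atTop ∧ ∀ τ, max (Kerr.rPlus (mass i) (spin i)) 0 + 1 ≤ R i τ) ∧ (∀ i, Tendsto (fun τ ↦ 𝒟.truncDeviationCk (B i) (Ψ i) 2 (R i τ) τ) atTop (nhds 0)) ∧ ∀ τ₁, τ₀ < τ₁ → O \ (Ψ₀ '' M₀.lateRegion τ₁ ∪ ⋃ i, Ψ i '' {x | τ₁ < (B i).time x.1 ∧ (B i).radius x.1 ≤ R i ((B i).time x.1)}) ⊆ 𝒟.metric.causalPast 𝒟.timeOrientation (Ψ₀ '' M₀.timeSlab τ₁ ∪ ⋃ i, Ψ i '' (B i).truncTimeSlab (R i τ₁) τ₁))) ∧ O = Summit.FinalStateConjecture.exteriorOf 𝒟.toCauchyDevelopment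 (Ψ₀ '' M₀.lateRegion τ₀ ∪ ⋃ i, Ψ i '' (B i).lateRegion τ₀) ∧ Summit.FinalStateConjecture.RaysStayInClosure 𝒟.toCauchyDevelopment O ∧ ((∀ i, Summit.FinalStateConjecture.IsOrthochronous (motion i).1) ∧ (∀ i r, ∀ᶠ τ in atTop, ∀ x ∈ (B i).truncTimeSlab r τ, 𝒟.timeOrientation.IsFutureDirected (mfderiv 𝓘(ℝ, E4) (𝓡 4) (Ψ i) x (((motion i).1 : E4 ≃L[ℝ] E4) (Kerr.timeVector (mass i) (spin i) (poincareInv (motion i).1 (motion i).2 x.1))))) ∧ ∀ᶠ τ in atTop, ∀ x ∈ M₀.timeSlab τ, 𝒟.timeOrientation.IsFutureDirected (mfderiv 𝓘(ℝ, E4) (𝓡 4) Ψ₀ x (E4.basisVector 0)))) → ∀ i, mass i ≤ M := by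
  sorry

/-- **Stub 3** (L, open): the late collar-superenergy budget — see `CollarBudget`.
[cite: Senovilla2000, §§2–4] [cite: ChristodoulouKlainerman1993, Ch. 7] -/
theorem stub_collarBudget :
    ∀ (X : Type) [TopologicalSpace X] [ChartedSpace E3 X] [IsManifold (𝓡 3) (⊤ : ℕ∞) X] [T2Space X] [SecondCountableTopology X] [ConnectedSpace X], ∀ D ∈ admissibleVacuumData X, ∀ 𝒟 : VacuumCauchyDevelopment D, 𝒟.IsMaximal → Summit.FinalStateConjecture.HasCompleteNullInfinity 𝒟.toCauchyDevelopment → ∀ (O : Set 𝒟.carrier) (ι : Type) (mass spin : ι → ℝ) (motion : ι → lorentzGroup × E4) (τ₀ : ℝ) (B : ι → ModelBackground), B = (fun i ↦ boostedKerrBackground (motion i).1 (motion i).2 (mass i) (spin i)) → ∀ (Ψ : ∀ i, (B i).domain → 𝒟.carrier) (ρ : ι → ℝ → ℝ) (U₀ : TopologicalSpace.Opens E4) (M₀ : ModelBackground), M₀ = Minkowski.backgroundOn U₀ → ∀ (Ψ₀ : M₀.domain → 𝒟.carrier), ∀ (G : ι → E4 → (E4 →L[ℝ] E4 →L[ℝ]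 ℝ)), G = (fun i w ↦ 𝒟.deviationExtend (B i) (Ψ i) w + (B i).bilin w) → (((∀ i, Kerr.IsSubextremal (mass i) (spin i)) ∧ (∀ i, 𝒟.IsLateChart (B i) O τ₀ (Ψ i)) ∧ (∀ i R, Tendsto (fun τ ↦ 𝒟.truncDeviationCk (B i) (Ψ i) 2 R τ) atTop (nhds 0))) ∧ ((∀ R, ∃ τ₁, Pairwise (Function.onFun Disjoint fun i ↦ Ψ i '' (B i).truncLateRegion τ₁ R)) ∧ (∀ i, Tendsto (fun t ↦ ρ i t / t) atTop (nhds 0)) ∧ ({x : E4 | τ₀ < x 0 ∧ ∀ i, ρ i (x 0) < Kerr.radius (spin i) (poincareInv (motion i).1 (motion i).2 x)} ⊆ (U₀ : Set E4)) ∧ 𝒟.IsLateChart M₀ O τ₀ Ψ₀ ∧ Tendsto (fun τ ↦ 𝒟.deviationCk M₀ Ψ₀ 2 τ) atTop (nhds 0) ∧ (O \ ((⋃ i, Ψ i '' (B i).lateRegion τ₀) ∪ Ψ₀ '' M₀.lateRegion τ₀) ⊆ 𝒟.metric.causalPast 𝒟.timeOrientation ((⋃ i, Ψ i '' (B i).timeSlab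 τ₀) ∪ Ψ₀ '' M₀.timeSlab τ₀)) ∧ (∃ R : ι → ℝ → ℝ, (∀ i, Tendsto (R i) atTop atTop ∧ ∀ τ, max (Kerr.rPlus (mass i) (spin i)) 0 + 1 ≤ R i τ) ∧ (∀ i, Tendsto (fun τ ↦ 𝒟.truncDeviationCk (B i) (Ψ i) 2 (R i τ) τ) atTop (nhds 0)) ∧ ∀ τ₁, τ₀ < τ₁ → O \ (Ψ₀ '' M₀.lateRegion τ₁ ∪ ⋃ i, Ψ i '' {x | τ₁ < (B i).time x.1 ∧ (B i).radius x.1 ≤ R i ((B i).time x.1)}) ⊆ 𝒟.metric.causalPast 𝒟.timeOrientation (Ψ₀ '' M₀.timeSlab τ₁ ∪ ⋃ i, Ψ i '' (B i).truncTimeSlab (R i τ₁) τ₁))) ∧ O = Summit.FinalStateConjecture.exteriorOf 𝒟.toCauchyDevelopment (Ψ₀ '' M₀.lateRegion τ₀ ∪ ⋃ i, Ψ i '' (B i).lateRegion τ₀) ∧ Summit.FinalStateConjecture.RaysStayInClosure 𝒟.toCauchyDevelopment O ∧ ((∀ i, Summit.FinalStateConjecture.IsOrthochronous (motion i).1) ∧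 (∀ i r, ∀ᶠ τ in atTop, ∀ x ∈ (B i).truncTimeSlab r τ, 𝒟.timeOrientation.IsFutureDirected (mfderiv 𝓘(ℝ, E4) (𝓡 4) (Ψ i) x (((motion i).1 : E4 ≃L[ℝ] E4) (Kerr.timeVector (mass i) (spin i) (poincareInv (motion i).1 (motion i).2 x.1))))) ∧ ∀ᶠ τ in atTop, ∀ x ∈ M₀.timeSlab τ, 𝒟.timeOrientation.IsFutureDirected (mfderiv 𝓘(ℝ, E4) (𝓡 4) Ψ₀ x (E4.basisVector 0)))) → ∃ C < (⊤ : ENNReal), ∀ s : Finset ι, ∃ᶠ τ in atTop, (∑ i ∈ s, ∫⁻ y in {y | y ∈ (B i).domain ∧ (B i).time y = τ ∧ (B i).radius y ≤ 4 * mass i}, ENNReal.ofReal ((1 / 8 : ℝ) * MetricCoord.tnormSq (fun z ↦ G i z + (2 * (-((fderiv ℝ (B i).time z) (MetricCoord.sharpAt (G i) z (fderiv ℝ (B i).time z))))⁻¹) • E4.tmul (fderiv ℝ (B i).time z) (fderiv ℝ (B i).time z)) (EuclideanSpace.basisFun (Fin 4) ℝ).toBasis (MetricCoord.rm4 (G i)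 (EuclideanSpace.basisFun (Fin 4) ℝ).toBasis) y) ∂μH[3]) ≤ C := by
  sorry

/-! ## §3 The composition (kernel-checked; no `sorry` of its own) -/

/-- **THE CRUX BY NAME from the four registered stubs.** Tame Christodoulou genericity is monotone
in the property (`IsTameChristodoulouGeneric.mono`): it suffices that for every ADMISSIBLE datum the
property of Stub 1 implies the crux's property; MGHD existence is Stub 0, the DR end `(e, M)` comes
with admissibility, the settled family and its clauses are Stub 1's, the mass bound is Stub 2 and
the superenergy budget Stub 3, both applied to that family. [folklore] -/
theorem GenericCountableKerrSettling_of :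
    Goal.stub_mghdExists → Goal.stub_countableSettling → Goal.stub_remnantMassBound →
      Goal.stub_collarBudget → GenericCountableKerrSettling := by
  intro h₀ hS hM hB X _ _ _ _ _ _
  refine (hS X).mono fun D hD h ↦ ⟨h₀ X D hD, fun 𝒟 hmax ↦ ?_⟩
  -- Stub 1's package for this MGHD: complete 𝓘⁺ and the honestly settled ι-family with its clauses
  obtain ⟨hscri, O, ι, mass, spin, motion, τ₀, B, hBdef, Ψ, ρ, U₀, M₀, hM₀def, Ψ₀, hnear, hfar, hO,
    hrays, horient⟩ := h 𝒟 hmax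
  -- the sole DR end of the admissible datum and its mass parameter
  obtain ⟨e, hsole, M, hAF⟩ := exists_isSoleEnd_of_mem_admissibleVacuumData hD
  -- Stub 2: remnant masses ≤ ADM mass parameter; Stub 3: the late collar-superenergy budget
  have hmass := hM X D hD e M hsole hAF 𝒟 hmax hscri O ι mass spin motion τ₀ B hBdef Ψ ρ U₀ M₀ hM₀def
    Ψ₀ ⟨hnear, hfar, hO, hrays, horient⟩
  have hSE := hB X D hD 𝒟 hmax hscri O ι mass spin motion τ₀ B hBdef Ψ ρ U₀ M₀ hM₀def Ψ₀ _ rfl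
    ⟨hnear, hfar, hO, hrays, horient⟩
  -- the defining equations of `B` and `M₀` are the crux's `let`s
  subst hBdef hM₀def
  exact ⟨hscri, e, M, hAF, O, ι, mass, spin, motion, τ₀, Ψ, ρ, U₀, Ψ₀, hnear, hfar, hO, hrays,
    horient, hmass, hSE⟩

/-! ### Consistency: each registered stub, stated EXPANDED, IS the named statement of §1 (by `δ`). -/

theorem admissibleMGHDExistence_holds : AdmissibleMGHDExistence := stub_mghdExists
theorem countableSettling_holds : CountableSettling := stub_countableSettling
theorem remnantMassBound_holds : RemnantMassBound := stub_remnantMassBound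
theorem collarBudget_holds : CollarBudget := stub_collarBudget

/-- **The crux from the skeleton** (closed modulo the four `sorry`s). [folklore] -/
theorem GenericCountableKerrSettling_proof : GenericCountableKerrSettling :=
  GenericCountableKerrSettling_of stub_mghdExists stub_countableSettling stub_remnantMassBound
    stub_collarBudget

/-! ## §4 Sanity (no `sorry`): the crux implies Stub 1 — it is a genuine WEAKENING of the crux -/

/-- The crux implies tame-generic countable Kerr settling (drop the DR end, the mass bound and the
superenergy budget under `mono`). [folklore] -/
theorem countableSettling_of_crux (h : GenericCountableKerrSettling) : CountableSettling := by
  intro X _ _ _ _ _ _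
  refine (h X).mono fun D _ hP 𝒟 hmax ↦ ?_
  obtain ⟨hscri, e, M, hAF, O, ι, mass, spin, motion, τ₀, Ψ, ρ, U₀, Ψ₀, hnear, hfar, hO, hrays,
    horient, hmass, hSE⟩ := hP.2 𝒟 hmax
  exact ⟨hscri, O, ι, mass, spin, motion, τ₀, _, rfl, Ψ, ρ, U₀, _, rfl, Ψ₀, hnear, hfar, hO, hrays,
    horient⟩

end Summit.FinalStateConjecture.FinalStateConjecture.Cruxes.GenericCountableKerrSettling.Birth
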